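import Mathlib
/-! # Stub `stub_raySeries` — crux `TwoProducts` (stmt-ValiantsHypothesis-5906), line `corner-log-linearization`
   The binomial rung `t ≤ 2`: if every factor `u_i`, `v_i` has constant term `1` and at most two monomials, then
   `u_i - 1 = monomial g_i c_i`, so the truncated log series
   `Λ_R = Σ_{r=1}^{R} ((−1)^{r+1}/r) • (Σ_i (u_i − 1)^r − Σ_i (v_i − 1)^r)` is supported on the `≤ 2n` rays
   `ℕ • g_i`, `ℕ • g'_i`.  Two distinct stable unique minimisers (for positive integer weights) on one ray are
   impossible (for large `R` each would have to beat the other), so picking one representative per ray covers the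
   set of stable south-west log vertices by `≤ n + n` points: its `ncard` is `≤ 2n`. [folklore] -/
set_option linter.dupNamespace false -- single-conjunct summit: `ValiantsHypothesis.ValiantsHypothesis`
namespace Summit.ValiantsHypothesis.ValiantsHypothesis.Theorems.TwoProducts.RaySeries
open scoped BigOperators

/-- A multivariate polynomial with at most one exponent in its support is a monomial. [folklore] -/
theorem exists_eq_monomial_of_card_support_le_one {σ R : Type*} [CommSemiring R] (p : MvPolynomial σ R)
    (hp : p.support.card ≤ 1) : ∃ (g : σ →₀ ℕ) (c : R), p = MvPolynomial.monomial g c := by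
  classical
  obtain ⟨g, hg⟩ := Finset.card_le_one_iff_subset_singleton.mp hp
  refine ⟨g, p.coeff g, ?_⟩
  ext m
  rw [MvPolynomial.coeff_monomial]
  split_ifs with hgm
  · subst hgm; rfl
  · exact MvPolynomial.notMem_support_iff.mp fun hm => hgm (Finset.mem_singleton.mp (hg hm)).symm

/-- A polynomial with constant term `1` and at most two monomials differs from `1` by a monomial. [folklore] -/
theorem sub_one_eq_monomial {σ R : Type*} [CommRing R] [Nontrivial R] (q : MvPolynomial σ R)
    (hq : q.support.card ≤ 2) (h0 : q.coeff 0 = 1) :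
    ∃ (g : σ →₀ ℕ) (c : R), q - 1 = MvPolynomial.monomial g c := by
  classical
  refine exists_eq_monomial_of_card_support_le_one (q - 1) ?_
  have hmem : (0 : σ →₀ ℕ) ∈ q.support := by
    rw [MvPolynomial.mem_support_iff, h0]; exact one_ne_zero
  have hsub : (q - 1).support ⊆ q.support.erase 0 := by
    intro m hm
    rw [MvPolynomial.mem_support_iff, MvPolynomial.coeff_sub, MvPolynomial.coeff_one] at hm
    rw [Finset.mem_erase, MvPolynomial.mem_support_iff]
    by_cases hm0 : m = 0
    · subst hm0; simp [h0] at hm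
    · refine ⟨hm0, ?_⟩
      simpa [Ne.symm hm0] using hm
  have hle := Finset.card_le_card hsub
  rw [Finset.card_erase_of_mem hmem] at hle
  omega

/-- Support confinement: if `u_i - 1`, `v_i - 1` are monomials with exponents `g_i`, `g'_i`, every exponent in the
support of the truncated log series `Λ_R` lies on one of the rays `ℕ • g_i`, `ℕ • g'_i`. [folklore] -/
theorem mem_ray_of_mem_support {n : ℕ} (u v : Fin n → MvPolynomial (Fin 2) ℂ) (g g' : Fin n → Fin 2 →₀ ℕ)
    (c c' : Fin n → ℂ) (hu : ∀ i, u i - 1 = MvPolynomial.monomial (g i) (c i))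
    (hv : ∀ i, v i - 1 = MvPolynomial.monomial (g' i) (c' i)) (R : ℕ) (e : Fin 2 →₀ ℕ)
    (he : e ∈ (∑ r ∈ Finset.Icc 1 R, ((-1 : ℂ) ^ (r + 1) / (r : ℂ)) •
            (∑ i, (u i - 1) ^ r - ∑ i, (v i - 1) ^ r)).support) :
    (∃ (i : Fin n) (r : ℕ), e = r • g i) ∨ (∃ (i : Fin n) (r : ℕ), e = r • g' i) := by
  classical
  by_contra h
  push Not at h
  obtain ⟨h1, h2⟩ := h
  have h1' : ∀ (i : Fin n) (r : ℕ), r • g i ≠ e := fun i r => Ne.symm (h1 i r)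
  have h2' : ∀ (i : Fin n) (r : ℕ), r • g' i ≠ e := fun i r => Ne.symm (h2 i r)
  rw [MvPolynomial.mem_support_iff] at he
  apply he
  simp only [MvPolynomial.coeff_sum, MvPolynomial.coeff_smul, MvPolynomial.coeff_sub, hu, hv,
    MvPolynomial.monomial_pow, MvPolynomial.coeff_monomial, h1', h2', if_false]
  simp

/-- Two stable unique minimisers (for positive integer weights) lying on a common ray `ℕ • g` coincide: for `R`
large both lie in `S R`, and each would have strictly smaller weight than the other. [folklore] -/
theorem eq_of_mem_ray (S : ℕ → Finset (Fin 2 →₀ ℕ)) (g e₁ e₂ : Fin 2 →₀ ℕ) (r₁ r₂ : ℕ)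
    (he₁ : e₁ = r₁ • g) (he₂ : e₂ = r₂ • g) (w₁ w₂ : Fin 2 → ℤ)
    (h₁0 : 0 < w₁ 0) (h₁1 : 0 < w₁ 1) (h₂0 : 0 < w₂ 0) (h₂1 : 0 < w₂ 1)
    (hs₁ : ∀ R : ℕ, w₁ 0 * (e₁ 0 : ℤ) + w₁ 1 * (e₁ 1 : ℤ) < (R : ℤ) →
      (e₁ ∈ S R ∧ ∀ e' ∈ S R, e' ≠ e₁ →
        w₁ 0 * (e₁ 0 : ℤ) + w₁ 1 * (e₁ 1 : ℤ) < w₁ 0 * (e' 0 : ℤ) + w₁ 1 * (e' 1 : ℤ)))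
    (hs₂ : ∀ R : ℕ, w₂ 0 * (e₂ 0 : ℤ) + w₂ 1 * (e₂ 1 : ℤ) < (R : ℤ) →
      (e₂ ∈ S R ∧ ∀ e' ∈ S R, e' ≠ e₂ →
        w₂ 0 * (e₂ 0 : ℤ) + w₂ 1 * (e₂ 1 : ℤ) < w₂ 0 * (e' 0 : ℤ) + w₂ 1 * (e' 1 : ℤ))) :
    e₁ = e₂ := by
  by_contra hne
  set ω₁ : ℤ := w₁ 0 * (e₁ 0 : ℤ) + w₁ 1 * (e₁ 1 : ℤ) with hω₁
  set ω₂ : ℤ := w₂ 0 * (e₂ 0 : ℤ) + w₂ 1 * (e₂ 1 : ℤ) with hω₂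
  have hR₁ : ω₁ < ((ω₁.toNat + ω₂.toNat + 1 : ℕ) : ℤ) := by
    have := Int.self_le_toNat ω₁; push_cast; omega
  have hR₂ : ω₂ < ((ω₁.toNat + ω₂.toNat + 1 : ℕ) : ℤ) := by
    have := Int.self_le_toNat ω₂; push_cast; omega
  obtain ⟨hm₁, hmin₁⟩ := hs₁ _ hR₁
  obtain ⟨hm₂, hmin₂⟩ := hs₂ _ hR₂
  have lt₁ := hmin₁ e₂ hm₂ (Ne.symm hne)
  have lt₂ := hmin₂ e₁ hm₁ hne
  rw [hω₁, he₁, he₂] at lt₁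
  rw [hω₂, he₁, he₂] at lt₂
  simp only [Finsupp.smul_apply, smul_eq_mul, Nat.cast_mul] at lt₁ lt₂
  have hA₁ : (0 : ℤ) ≤ w₁ 0 * (g 0 : ℤ) + w₁ 1 * (g 1 : ℤ) := by positivity
  have hA₂ : (0 : ℤ) ≤ w₂ 0 * (g 0 : ℤ) + w₂ 1 * (g 1 : ℤ) := by positivity
  have k₁ : (r₁ : ℤ) * (w₁ 0 * (g 0 : ℤ) + w₁ 1 * (g 1 : ℤ)) <
      (r₂ : ℤ) * (w₁ 0 * (g 0 : ℤ) + w₁ 1 * (g 1 : ℤ)) := by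
    convert lt₁ using 1 <;> ring
  have k₂ : (r₂ : ℤ) * (w₂ 0 * (g 0 : ℤ) + w₂ 1 * (g 1 : ℤ)) <
      (r₁ : ℤ) * (w₂ 0 * (g 0 : ℤ) + w₂ 1 * (g 1 : ℤ)) := by
    convert lt₂ using 1 <;> ring
  have c₁ := lt_of_mul_lt_mul_right k₁ hA₁
  have c₂ := lt_of_mul_lt_mul_right k₂ hA₂
  omega

/-- Counting: if every support `S R` lies on the rays `ℕ • g_i`, `ℕ • g'_i` (`i : Fin n`), then a set of stable
unique minimisers (for positive integer weights) has at most `2n` elements — one per ray. [folklore] -/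
theorem ncard_le_of_rays (n : ℕ) (S : ℕ → Finset (Fin 2 →₀ ℕ)) (g g' : Fin n → Fin 2 →₀ ℕ)
    (hS : ∀ R, ∀ e ∈ S R, (∃ (i : Fin n) (r : ℕ), e = r • g i) ∨ (∃ (i : Fin n) (r : ℕ), e = r • g' i))
    (LV : Set (Fin 2 →₀ ℕ))
    (hLV : ∀ e ∈ LV, ∃ w : Fin 2 → ℤ, 0 < w 0 ∧ 0 < w 1 ∧
      ∀ R : ℕ, w 0 * (e 0 : ℤ) + w 1 * (e 1 : ℤ) < (R : ℤ) →
        (e ∈ S R ∧ ∀ e' ∈ S R, e' ≠ e →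
          w 0 * (e 0 : ℤ) + w 1 * (e 1 : ℤ) < w 0 * (e' 0 : ℤ) + w 1 * (e' 1 : ℤ))) :
    LV.ncard ≤ 2 * n := by
  classical
  -- one representative of `LV` per ray (if the ray meets `LV` at all)
  have key : ∀ i : Fin n, ∃ f : Fin 2 →₀ ℕ,
      (∃ e ∈ LV, ∃ r : ℕ, e = r • g i) → (f ∈ LV ∧ ∃ r : ℕ, f = r • g i) := by
    intro i
    by_cases h : ∃ e ∈ LV, ∃ r : ℕ, e = r • g i
    · obtain ⟨e, he, r, hr⟩ := h
      exact ⟨e, fun _ => ⟨he, r, hr⟩⟩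
    · exact ⟨0, fun h' => absurd h' h⟩
  have key' : ∀ i : Fin n, ∃ f : Fin 2 →₀ ℕ,
      (∃ e ∈ LV, ∃ r : ℕ, e = r • g' i) → (f ∈ LV ∧ ∃ r : ℕ, f = r • g' i) := by
    intro i
    by_cases h : ∃ e ∈ LV, ∃ r : ℕ, e = r • g' i
    · obtain ⟨e, he, r, hr⟩ := h
      exact ⟨e, fun _ => ⟨he, r, hr⟩⟩
    · exact ⟨0, fun h' => absurd h' h⟩
  choose F hF using key
  choose F' hF' using key'
  have hsub : LV ⊆ Set.range F ∪ Set.range F' := by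
    intro e he
    obtain ⟨w, hw0, hw1, hst⟩ := hLV e he
    have hR : w 0 * (e 0 : ℤ) + w 1 * (e 1 : ℤ) <
        (((w 0 * (e 0 : ℤ) + w 1 * (e 1 : ℤ)).toNat + 1 : ℕ) : ℤ) := by
      have := Int.self_le_toNat (w 0 * (e 0 : ℤ) + w 1 * (e 1 : ℤ)); push_cast; omega
    rcases hS _ e (hst _ hR).1 with ⟨i, r, hr⟩ | ⟨i, r, hr⟩
    · obtain ⟨hFi, r', hr'⟩ := hF i ⟨e, he, r, hr⟩
      obtain ⟨w', hw'0, hw'1, hst'⟩ := hLV _ hFi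
      exact Or.inl ⟨i, eq_of_mem_ray S (g i) (F i) e r' r hr' hr w' w hw'0 hw'1 hw0 hw1 hst' hst⟩
    · obtain ⟨hFi, r', hr'⟩ := hF' i ⟨e, he, r, hr⟩
      obtain ⟨w', hw'0, hw'1, hst'⟩ := hLV _ hFi
      exact Or.inr ⟨i, eq_of_mem_ray S (g' i) (F' i) e r' r hr' hr w' w hw'0 hw'1 hw0 hw1 hst' hst⟩
  have hF_le : (Set.range F).ncard ≤ n := by
    rw [← Set.image_univ]
    exact (Set.ncard_image_le Set.finite_univ).trans (by simp)
  have hF'_le : (Set.range F').ncard ≤ n := by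
    rw [← Set.image_univ]
    exact (Set.ncard_image_le Set.finite_univ).trans (by simp)
  calc LV.ncard ≤ (Set.range F ∪ Set.range F').ncard :=
        Set.ncard_le_ncard hsub ((Set.finite_range F).union (Set.finite_range F'))
    _ ≤ (Set.range F).ncard + (Set.range F').ncard := Set.ncard_union_le _ _
    _ ≤ n + n := add_le_add hF_le hF'_le
    _ = 2 * n := by ring

/-- STUB `stub_raySeries` (the binomial rung `t ≤ 2`): if every factor has constant term `1` and at most two
monomials, the set of stable south-west vertices of the truncated log series
`Λ_R = Σ_{r=1}^{R} ((−1)^{r+1}/r) • (Σ_i (u_i − 1)^r − Σ_i (v_i − 1)^r)` has at most `2n` elements. [folklore] -/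
theorem stub_raySeries : ∀ (n : ℕ) (u v : Fin n → MvPolynomial (Fin 2) ℂ),
    (∀ i, (u i).support.card ≤ 2) → (∀ i, (v i).support.card ≤ 2) →
    (∀ i, MvPolynomial.coeff 0 (u i) = 1) → (∀ i, MvPolynomial.coeff 0 (v i) = 1) →
    {e : Fin 2 →₀ ℕ | ∃ w : Fin 2 → ℤ, 0 < w 0 ∧ 0 < w 1 ∧ ∀ R : ℕ, w 0 * (e 0 : ℤ) + w 1 * (e 1 : ℤ) < (R : ℤ) →
      (e ∈ (∑ r ∈ Finset.Icc 1 R, ((-1 : ℂ) ^ (r + 1) / (r : ℂ)) •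
            (∑ i, (u i - 1) ^ r - ∑ i, (v i - 1) ^ r)).support ∧
        ∀ e' ∈ (∑ r ∈ Finset.Icc 1 R, ((-1 : ℂ) ^ (r + 1) / (r : ℂ)) •
            (∑ i, (u i - 1) ^ r - ∑ i, (v i - 1) ^ r)).support, e' ≠ e →
          w 0 * (e 0 : ℤ) + w 1 * (e 1 : ℤ) < w 0 * (e' 0 : ℤ) + w 1 * (e' 1 : ℤ))}.ncard ≤ 2 * n := by
  intro n u v hu hv hu0 hv0
  choose g c hg using fun i => sub_one_eq_monomial (u i) (hu i) (hu0 i)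
  choose g' c' hg' using fun i => sub_one_eq_monomial (v i) (hv i) (hv0 i)
  exact ncard_le_of_rays n (fun R => (∑ r ∈ Finset.Icc 1 R, ((-1 : ℂ) ^ (r + 1) / (r : ℂ)) •
      (∑ i, (u i - 1) ^ r - ∑ i, (v i - 1) ^ r)).support) g g'
    (fun R e he => mem_ray_of_mem_support u v g g' c c' hg hg' R e he) _ (fun e he => he)

end Summit.ValiantsHypothesis.ValiantsHypothesis.Theorems.TwoProducts.RaySeries
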